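import Summits.QuantumFields.YangMills.Theorems.UnitScaleTiltProp7LODAssembly
import Summits.QuantumFields.YangMills.Theorems.UnitScaleTiltProp7LODCutoffDock
import Summits.QuantumFields.YangMills.Theorems.UnitScaleTiltProp7CovariantCurlCutoffCommutator
import Summits.QuantumFields.YangMills.Theorems.UnitScaleTiltProp7CutoffCommutatorFamily
import Summits.QuantumFields.YangMills.Theorems.UnitScaleTiltProp7LODSlotK2
import Summits.QuantumFields.YangMills.Theorems.UnitScaleTiltProp7QkCutoffCommutator
import Summits.QuantumFields.YangMills.Theorems.UnitScaleTiltProp7LocalComparisonCubeGauge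
import Summits.QuantumFields.YangMills.Theorems.UnitScaleTiltProp7DeltaEtaAlmostPositive
import Summits.QuantumFields.YangMills.Theorems.UnitScaleTiltProp7NSIntertwinerOfRecord
import Summits.QuantumFields.YangMills.Theorems.UnitScaleTiltProp7DivergenceAbsorptionOfRegPr
import Summits.QuantumFields.YangMills.Theorems.UnitScaleTiltProp7PTermLocalGaugeKnit
import HarnessLib

/-!
# Route `UnitScaleTilt`, crux K1 «MinimiserStabilityRegPr» (stmt-QuantumFields-19200), EX row `hGF` — **(L6) THE LOD ASSEMBLY AT THE MEMBER, BY NAME**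
# (w5-19200 g13's LOCATE-L6-DISCHARGE §2 «what remains is the BY-NAME final assembly»; chair ★`ym-ust-19200-p1` g24 03:11:42Z «GO, px10 g11 ASSEMBLES» with three pins)

Cell `ym3-torus` (HUMAN RULING D-0037; rung R3 = SU(2) YM₃ on T³ — NOT d = 4, NOT infinite volume, NOT a mass gap, NOT the Clay problem).  Width seat `ym3-torus-px10` (gen 11).
THEOREMS ONLY (0 `def`, 0 `sorry`, default heartbeats); `--supports stmt-QuantumFields-19200 --as helper`; count-neutral.

WHAT.  w5's (L6) KNIT ✓`Prop7LODAssembly.curvedTarget_of_LOD_topMean` proves the curved target `γ_LOD·‖A‖² ≤ q_{U₀}(A)`,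
`q_{U₀}(A) = re⟪A, Δ^η(U₀)A⟫ + ‖projR(covLapSite U₀)Q″(D*_{U₀}A)‖² + a‖Q_k(U₀)A‖²` (`a = a₀(c₀∕cB)(L^{K−n})³`), from SEVEN abstract binders (χ)(H)(K2)(K3)(Φ)(C) over an
arbitrary cut-off family.  THIS FILE INSTANTIATES THEM AT THE MEMBER `(F, n, K)`, `U₀ ∈ RegPr F n K ε₀` (`10¹⁰L⁶ε₀ ≤ 1`, `10¹²L³ε₀ ≤ 1`), at px17's corner cut-off family of scale `s`
(✓`Prop7LODCutoffDock.exists_LOD_cutoffs_corner`, `J := Site (F.P K) 0`, `s < m + n`, no wrap `2(3L^sℓ + 8ℓ + 1) ≤ sitesPerDir 0`, `ℓ = L^{K−n}`), and DISCHARGES BY NAME: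
* (χ) `hM hN₂ hN₃` — the family's Parseval identities (✓`exists_LOD_cutoffs_corner`, `le_of_eq`);
* (H) `hq₁` — ✓`Prop7CovariantCurlCutoffCommutator.sum_re_inner_DeltaEta_cutoffOps_le` (w7), `ρ = (1+θ⁻¹)·11520∕L^{2s} + (2+θ)·1029ε₀`;
* (K2) `hK₂` — ✓`Prop7LODSlotK2.hK2_of_rows` (w5) over (K2a) ✓`Prop7CutoffCommutatorFamily.sum_normSq_Dstar_comm_le_of_dock` (px17, `κD² = 8640∕L^{2s}`) and (K2e)
  ✓`Prop7DeltaEtaAlmostPositive.re_inner_DeltaEta_toL2_ge` (`ν = 1029ε₀`), with (K2b) `hKP` and (K2d) `hDst` DISPLAYED;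
* (K3) `hK₃` — ✓`Prop7QkCutoffCommutator.hK3_of_readings` (routeR-w4), `κ₃² = 12441600·a₀∕L^{2s}`, `μ₃ = 0`;
* (Φ) `Φ_c := Ad_{axialT U₀ c}` with `‖Φ_c B‖ = ‖B‖` — ✓`Prop7LocalDivergenceComparison.norm_toL2_conj_eq` (px12's letters);
* (C) `hcmp` per cube — ✓`Prop7LocalComparisonCubeGauge.localComparison_of_cube_cubeGauge` (routeR-w4, over routeR-w3's ✓`localComparison_of_cube`), its support radius
  `R₀ = 3L^sℓ` by ✓`Prop7LODCubeGaugeFamily.tdist_le_of_hsupp`, its `Q₀`-sequence by ✓`Prop7NSIntertwinerOfRecord.exists_linear_avgSeq` from the ∀-form `htop` of `Q″`,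
  with `hloc` (per cube, for SOME intertwiner `Q_c` at the cube-gauged background) and `hP1abs` (at `U₀ = 1`) DISPLAYED.
So EXACTLY FOUR member rows stay displayed, each with ONE real letter: (K2b) `hKP` (κP; px10 g10's ✓`Prop7LODSlotK2Member.sum_normSq_comm_le_of_kernelBlockBound` reduces it to a
block-kernel decay of `projR(covLapSite U₀)Q″`), (K2d) `hDst` (cR; routeR-w4 g27's pen `…DivergenceAbsorptionOfRegPr`), (L5″) `hloc` (δP; routeR-w2 g13's pen `…LocalProjectorRowMember`
over px5's rows) and `hP1abs` (c₆; routeR-w4 g27 §4) — and two Peter–Paul parameters `θ` (IMS) and `θc` (cube comparison), DECOUPLED.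
* `curvedTarget_member_raw` — the knit with the suppliers' constants as printed (terms in `η⁻¹`, `regThreshold`, `(F.P K).d`);
* ★★★ `curvedTarget_member` — THE SAME WITH THE COEFFICIENT IN CLOSED K-FREE FORM (chair's pin (2)–(3) check: no `K`, `n`, `|T³|` survives):
  `γ = ((1 − 3θc − δP)∕(4·Cst 3 a₀) − e − ρ − (1+θ⁻¹)·(17280∕L^{2s} + 2κP²(cR + 1029ε₀) + 12441600a₀∕L^{2s})) ∕ (1 + θ + 2(1+θ⁻¹)κP²)`,
  `e = (1+θc⁻¹)·160ε₀²(3L^s+7)² + (1+θc)·1029ε₀ + 4a₀(1+θc⁻¹)(3·10¹⁰L¹⁰ε₀² + 768ε₀²(3L^s+7)²) + (2θc+δP)·c₆`.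
`Q″` enters through its ∀-form `htop` only (the intertwiner of record of ✓`exists_intertwiner_of_regPr`, clause (iii); unique by ✓`avgSeq_unique`), exactly as in the `hT` binder of
✓`Prop7GaugeFixedRowDoorOfLODTarget.gaugeFixedRow_of_curvedTarget_of_le`; `hker` is not used by the knit.
HONEST SCOPE.  An assembly of landed rows; the four displayed rows, the window bookkeeping `γ > 0` (choose `θc`, `δP` against `c₆`, then `s`, then `ε₀` — w5's §3 ∕ chair's pin (3);
by px10 g10's LOCATE-SMALL-MEMBERS the admissible `s` excludes the small members `m + n ≤ s₀(L)`), `hT` for every member, `hGF`, (3.49), EX `stub_existenceMinimalOrbit` and the crux are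
NOT proved here; this is NOT the S45 event.

References: T. Bałaban, CMP **99** (1985) 389–434 [Balaban1985BackgroundPropagators] ((3.10)–(3.16) pp.392–393, (3.49) p.399, (3.100) pp.413–414, Thm 3.11 p.416, (3.118)–(3.122)
pp.419–420); CMP **95** (1984) 17–40 [Balaban1984PropagatorsI] (Prop. 1.1 (1.90) p.33); CMP **99** (1985) 75–102 [Balaban1985RegularSpaces] (Lemma 1 (1.25) p.79); B. Simon,
Ann. IHP A **38** (1983) 295–308 (IMS localisation).
-/

set_option autoImplicit false

noncomputable section

open scoped InnerProductSpace ComplexConjugate Matrix.Norms.L2Operator BigOperators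

namespace Summit.QuantumFields.YangMills.Theorems.Prop7LODAssemblyMember

open Literature.MathematicalPhysics.QuantumFieldTheory.Balaban1983to89
open Literature.MathematicalPhysics.QuantumFieldTheory.Balaban1983to89.T3ContinuumYM3Torus
open Literature.MathematicalPhysics.QuantumFieldTheory.Balaban1983to89.T3PrintedRegularMinimiser (RegPr)
open T4Continuum BlockAveraging
open BlockAveraging (Idx)
open B7Prop1Explicit (disp)
open B10Eq27TorusAxialLog (holT transl axialT)
open B7TransferAnalyticMean (meanCLM)
open B15DeterminingSets (embIter)
open B9Eq311L2Pairing (WL2)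
open B11Eq103H1Complex (SiteL2K BondL2K projR)
open Summit.QuantumFields.YangMills.Theorems.Prop8Chart (emlIterU)
open T3SectALandauChart (eta eta_pos bgUnits)
open T3RegularMinimiser (regThreshold regThreshold_pos)
open T3PrintedRegularOrbits (sites_eq)
open T3LevelShift (bondShift)
open Summit.QuantumFields.YangMills.Theorems.Prop7SectET3Transport (periodsT3)
open Summit.QuantumFields.YangMills.Theorems.Prop7SectET3HilbertLetters (W₂ toL2 toL2S toL2B DL2 DstarL2 covLapSite)
open Summit.QuantumFields.YangMills.Theorems.Prop7SectET3GaugeProjector (NS)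
open Summit.QuantumFields.YangMills.Theorems.Prop7SectET3WilsonHessian (DeltaEta)
open Summit.QuantumFields.YangMills.Theorems.Prop7SectET3CurvedPropagators (Qk)
open Summit.QuantumFields.YangMills.Theorems.Prop7LODAssembly (curvedTarget_of_LOD_topMean)
open Summit.QuantumFields.YangMills.Theorems.Prop7LODCutoffDock (exists_LOD_cutoffs_corner)
open Summit.QuantumFields.YangMills.Theorems.Prop7CovariantCurlCutoffCommutator (sum_re_inner_DeltaEta_cutoffOps_le)
open Summit.QuantumFields.YangMills.Theorems.Prop7CutoffCommutatorFamily (sum_normSq_Dstar_comm_le_of_dock sum_sq_sub_univ_le)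
open Summit.QuantumFields.YangMills.Theorems.Prop7LODSlotK2 (hK2_of_rows)
open Summit.QuantumFields.YangMills.Theorems.Prop7QkCutoffCommutator (hK3_of_readings)
open Summit.QuantumFields.YangMills.Theorems.Prop7LocalComparisonCubeGauge (localComparison_of_cube_cubeGauge)
open Summit.QuantumFields.YangMills.Theorems.Prop7LODCubeGaugeFamily (tdist_le_of_hsupp)
open Summit.QuantumFields.YangMills.Theorems.Prop7DeltaEtaAlmostPositive (re_inner_DeltaEta_toL2_ge)
open Summit.QuantumFields.YangMills.Theorems.Prop7NSIntertwinerOfRecord (exists_linear_avgSeq)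
open Summit.QuantumFields.YangMills.Theorems.Prop7LocalDivergenceComparison (norm_toL2_conj_eq)

/-- ★★ **(L6) THE CURVED TARGET AT THE MEMBER, SUPPLIERS' CONSTANTS AS PRINTED** — ✓`curvedTarget_of_LOD_topMean` at px17's corner cut-off family of scale `s` with (χ)(H)(K2a)(K2e)(K3)(Φ)(C)
discharged by name (module docstring) and the four member rows `hKP` (κP), `hDst` (cR), `hloc` (δP, per cube, ∃ intertwiner at the cube-gauged background), `hP1abs` (c₆) displayed;
Peter–Paul parameters `θ` (IMS rows) and `θc` (cube comparison, `3θc + δP ≤ 1`).  CONDITIONAL on the displayed rows; nothing of them is proved here.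
[cite: Balaban1985BackgroundPropagators, (3.49) p.399, (3.100) pp.413-414, Thm 3.11 p.416; Balaban1984PropagatorsI, Prop. 1.1 (1.90) p.33] -/
theorem curvedTarget_member_raw (F : T3Family) {n K : ℕ} (h : n ≤ K) (c₀ cB : ℝ) [Fact (0 < c₀)] [Fact (0 < cB)]
    {ε₀ : ℝ} (hε₀ : 0 < ε₀) (hε : 10 ^ 10 * (F.L : ℝ) ^ 6 * ε₀ ≤ 1) (hε12 : 10 ^ 12 * (F.L : ℝ) ^ 3 * ε₀ ≤ 1)
    (U₀ : GaugeField (F.P K) 0 (Matrix.specialUnitaryGroup (Fin 2) ℂ)) (hreg : RegPr F n K ε₀ U₀)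
    (s : ℕ) (hnK : n < K) (hs : s < F.m + n)
    (hwrap : 2 * ((3 * (F.L ^ s * F.L ^ (K - n))) + 8 * (F.P K).L ^ (K - n) + 1) ≤ (F.P K).sitesPerDir 0)
    {a₀ : ℝ} (ha₀ : 0 < a₀)
    (QU : SiteL2K ℂ 3 (periodsT3 F K) c₀ W₂ →ₗ[ℂ] (Site (F.P K) (K - n) → Matrix (Fin 2) (Fin 2) ℂ))
    (htop : ∀ (lam : Site (F.P K) 0 → Matrix (Fin 2) (Fin 2) ℂ) (ns : (j : ℕ) → Site (F.P K) j → Matrix (Fin 2) (Fin 2) ℂ), ns 0 = lam →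
      (∀ (j : ℕ) (y : Site (F.P K) (j + 1)), ns (j + 1) y = ns j (emb y) - meanCLM (Idx (F.P K)) (Matrix (Fin 2) (Fin 2) ℂ) fun i : Idx (F.P K) =>
          ns j (emb y) - ((holT (emlIterU j (bgUnits F K U₀)) (emb y) (stairWord i.2.1 (off i.1)) : (Matrix (Fin 2) (Fin 2) ℂ)ˣ) : Matrix (Fin 2) (Fin 2) ℂ) *
            ns j (transl (emb y) (disp (stairWord i.2.1 (off i.1)))) * (((holT (emlIterU j (bgUnits F K U₀)) (emb y) (stairWord i.2.1 (off i.1)))⁻¹ : (Matrix (Fin 2) (Fin 2) ℂ)ˣ) : Matrix (Fin 2) (Fin 2) ℂ)) →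
      ns (K - n) = QU (toL2S F K c₀ lam))
    (Q1 : SiteL2K ℂ 3 (periodsT3 F K) c₀ W₂ →ₗ[ℂ] (Site (F.P K) (K - n) → Matrix (Fin 2) (Fin 2) ℂ))
    (htop₁ : ∀ (lam : Site (F.P K) 0 → Matrix (Fin 2) (Fin 2) ℂ) (ns : (j : ℕ) → Site (F.P K) j → Matrix (Fin 2) (Fin 2) ℂ), ns 0 = lam →
      (∀ (j : ℕ) (y : Site (F.P K) (j + 1)), ns (j + 1) y = ns j (emb y) - meanCLM (Idx (F.P K)) (Matrix (Fin 2) (Fin 2) ℂ) fun i : Idx (F.P K) =>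
          ns j (emb y) - ((holT (emlIterU j (bgUnits F K (1 : GaugeField (F.P K) 0 (Matrix.specialUnitaryGroup (Fin 2) ℂ)))) (emb y) (stairWord i.2.1 (off i.1)) : (Matrix (Fin 2) (Fin 2) ℂ)ˣ) : Matrix (Fin 2) (Fin 2) ℂ) *
            ns j (transl (emb y) (disp (stairWord i.2.1 (off i.1)))) * (((holT (emlIterU j (bgUnits F K (1 : GaugeField (F.P K) 0 (Matrix.specialUnitaryGroup (Fin 2) ℂ)))) (emb y) (stairWord i.2.1 (off i.1)))⁻¹ : (Matrix (Fin 2) (Fin 2) ℂ)ˣ) : Matrix (Fin 2) (Fin 2) ℂ)) →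
      ns (K - n) = Q1 (toL2S F K c₀ lam))
    (hker₁ : LinearMap.ker Q1 ≤ NS F n K h c₀ cB (1 : GaugeField (F.P K) 0 (Matrix.specialUnitaryGroup (Fin 2) ℂ)))
    {θ θc δP κP cR c₆ : ℝ} (hθ : 0 < θ) (hθc : 0 < θc) (hδP : 0 ≤ δP) (hsmall : 3 * θc + δP ≤ 1) (hcR : 0 ≤ cR)
    (hKP : ∀ (χ : Site (F.P K) 0 → Site (F.P K) 0 → ℝ) (N₂ : Site (F.P K) 0 → (SiteL2K ℂ 3 (periodsT3 F K) c₀ W₂ →ₗ[ℂ] SiteL2K ℂ 3 (periodsT3 F K) c₀ W₂)),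
      (∀ (c : Site (F.P K) 0) (φ : SiteL2K ℂ 3 (periodsT3 F K) c₀ W₂) (x : Site (F.P K) 0), (toL2S F K c₀).symm (N₂ c φ) x = χ c x • (toL2S F K c₀).symm φ x) →
      (∀ (x : Site (F.P K) 0) (μ : Fin (F.P K).d), ∑ c : Site (F.P K) 0, (χ c (x.shift μ) - χ c x) ^ 2 ≤ (2880 / ((F.L : ℝ) ^ s * (F.L : ℝ) ^ (K - n)) ^ 2)) →
      ∀ y : SiteL2K ℂ 3 (periodsT3 F K) c₀ W₂, ∑ c : Site (F.P K) 0, ‖projR (covLapSite F n K c₀ U₀) QU (N₂ c y) - N₂ c (projR (covLapSite F n K c₀ U₀) QU y)‖ ^ 2 ≤ κP ^ 2 * ‖y‖ ^ 2)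
    (hDst : ∀ A : BondL2K ℂ 3 (periodsT3 F K) c₀ W₂, ‖DstarL2 F n K c₀ U₀ A‖ ^ 2 ≤ ‖projR (covLapSite F n K c₀ U₀) QU (DstarL2 F n K c₀ U₀ A)‖ ^ 2 + cR * ‖A‖ ^ 2)
    (hloc : ∀ c : Site (F.P K) 0, ∃ Qc : SiteL2K ℂ 3 (periodsT3 F K) c₀ W₂ →ₗ[ℂ] (Site (F.P K) (K - n) → Matrix (Fin 2) (Fin 2) ℂ),
      (∀ lam : Site (F.P K) 0 → Matrix (Fin 2) (Fin 2) ℂ, ∃ ns : (j : ℕ) → Site (F.P K) j → Matrix (Fin 2) (Fin 2) ℂ, ns 0 = lam ∧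
        (∀ (j : ℕ) (y : Site (F.P K) (j + 1)), ns (j + 1) y = ns j (emb y) - meanCLM (Idx (F.P K)) (Matrix (Fin 2) (Fin 2) ℂ) fun i : Idx (F.P K) =>
          ns j (emb y) - ((holT (emlIterU j (bgUnits F K (GaugeField.gaugeAct (axialT U₀ c) U₀))) (emb y) (stairWord i.2.1 (off i.1)) : (Matrix (Fin 2) (Fin 2) ℂ)ˣ) : Matrix (Fin 2) (Fin 2) ℂ) *
            ns j (transl (emb y) (disp (stairWord i.2.1 (off i.1)))) * (((holT (emlIterU j (bgUnits F K (GaugeField.gaugeAct (axialT U₀ c) U₀))) (emb y) (stairWord i.2.1 (off i.1)))⁻¹ : (Matrix (Fin 2) (Fin 2) ℂ)ˣ) : Matrix (Fin 2) (Fin 2) ℂ)) ∧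
        ns (K - n) = Qc (toL2S F K c₀ lam)) ∧
      ∀ X : PBond (F.P K) 0 → Matrix (Fin 2) (Fin 2) ℂ, (∀ b : PBond (F.P K) 0, X b ≠ 0 → Site.tdist c b.src ≤ (3 * (F.L ^ s * F.L ^ (K - n)))) →
        ‖⟪DstarL2 F n K c₀ (GaugeField.gaugeAct (axialT U₀ c) U₀) (toL2 F K c₀ (fun b => ((axialT U₀ c b.src : Matrix.specialUnitaryGroup (Fin 2) ℂ) : Matrix (Fin 2) (Fin 2) ℂ) * X b * star ((axialT U₀ c b.src : Matrix.specialUnitaryGroup (Fin 2) ℂ) : Matrix (Fin 2) (Fin 2) ℂ))),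
            (DstarL2 F n K c₀ (GaugeField.gaugeAct (axialT U₀ c) U₀) (toL2 F K c₀ (fun b => ((axialT U₀ c b.src : Matrix.specialUnitaryGroup (Fin 2) ℂ) : Matrix (Fin 2) (Fin 2) ℂ) * X b * star ((axialT U₀ c b.src : Matrix.specialUnitaryGroup (Fin 2) ℂ) : Matrix (Fin 2) (Fin 2) ℂ))) - projR (covLapSite F n K c₀ (GaugeField.gaugeAct (axialT U₀ c) U₀)) Qc (DstarL2 F n K c₀ (GaugeField.gaugeAct (axialT U₀ c) U₀) (toL2 F K c₀ (fun b => ((axialT U₀ c b.src : Matrix.specialUnitaryGroup (Fin 2) ℂ) : Matrix (Fin 2) (Fin 2) ℂ) * X b * star ((axialT U₀ c b.src : Matrix.specialUnitaryGroup (Fin 2) ℂ) : Matrix (Fin 2) (Fin 2) ℂ)))))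
            - (DstarL2 F n K c₀ (GaugeField.gaugeAct (axialT U₀ c) U₀) (toL2 F K c₀ (fun b => ((axialT U₀ c b.src : Matrix.specialUnitaryGroup (Fin 2) ℂ) : Matrix (Fin 2) (Fin 2) ℂ) * X b * star ((axialT U₀ c b.src : Matrix.specialUnitaryGroup (Fin 2) ℂ) : Matrix (Fin 2) (Fin 2) ℂ))) - projR (covLapSite F n K c₀ 1) Q1 (DstarL2 F n K c₀ (GaugeField.gaugeAct (axialT U₀ c) U₀) (toL2 F K c₀ (fun b => ((axialT U₀ c b.src : Matrix.specialUnitaryGroup (Fin 2) ℂ) : Matrix (Fin 2) (Fin 2) ℂ) * X b * star ((axialT U₀ c b.src : Matrix.specialUnitaryGroup (Fin 2) ℂ) : Matrix (Fin 2) (Fin 2) ℂ)))))⟫_ℂ‖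
          ≤ δP * ‖DstarL2 F n K c₀ (GaugeField.gaugeAct (axialT U₀ c) U₀) (toL2 F K c₀ (fun b => ((axialT U₀ c b.src : Matrix.specialUnitaryGroup (Fin 2) ℂ) : Matrix (Fin 2) (Fin 2) ℂ) * X b * star ((axialT U₀ c b.src : Matrix.specialUnitaryGroup (Fin 2) ℂ) : Matrix (Fin 2) (Fin 2) ℂ)))‖ ^ 2)
    (hP1abs : ∀ Y : PBond (F.P K) 0 → Matrix (Fin 2) (Fin 2) ℂ, ‖DstarL2 F n K c₀ 1 (toL2 F K c₀ Y)‖ ^ 2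
      ≤ ‖projR (covLapSite F n K c₀ 1) Q1 (DstarL2 F n K c₀ 1 (toL2 F K c₀ Y))‖ ^ 2 + c₆ * ‖toL2 F K c₀ Y‖ ^ 2) :
    ∀ A : BondL2K ℂ 3 (periodsT3 F K) c₀ W₂,
      (((1 - (3 * θc + δP)) * (1 / (4 * B5Prop11Plancherel.Cst 3 a₀)) - (((1 + θc⁻¹) * (16 * ((eta F n K)⁻¹) ^ 2 * (2 * regThreshold F n K ε₀ * ((((3 * (F.L ^ s * F.L ^ (K - n))) : ℕ) : ℝ) + 7 * (F.L : ℝ) ^ (K - n))) ^ 2) + (1 + θc) * (1029 * ε₀)) + (1 + θc⁻¹) * (12 * ((eta F n K)⁻¹) ^ 2 * (2 * regThreshold F n K ε₀ * ((((3 * (F.L ^ s * F.L ^ (K - n))) : ℕ) : ℝ) + 7 * (F.L : ℝ) ^ (K - n))) ^ 2)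
            + (1 + θc⁻¹) * (12 * ((eta F n K)⁻¹) ^ 2 * (2 * regThreshold F n K ε₀ * ((((3 * (F.L ^ s * F.L ^ (K - n))) : ℕ) : ℝ) + 7 * (F.L : ℝ) ^ (K - n))) ^ 2) + (a₀ * (c₀ / cB) * ((F.L : ℝ) ^ (K - n)) ^ 3) * ((1 + θc⁻¹) * (4 * (3 * 10 ^ 10 * (F.L : ℝ) ^ 10 * ε₀ ^ 2 + 192 * ((F.L : ℝ) ^ (K - n) * (2 * regThreshold F n K ε₀ * ((((3 * (F.L ^ s * F.L ^ (K - n))) : ℕ) : ℝ) + 7 * (F.L : ℝ) ^ (K - n)))) ^ 2) * (cB / (c₀ * ((F.L : ℝ) ^ (K - n)) ^ (F.P K).d)))) + (2 * θc + δP) * c₆) - ((1 + θ⁻¹) * (4 * ((eta F n K)⁻¹) ^ 2 * (2880 / ((F.L : ℝ) ^ s * (F.L : ℝ) ^ (K - n)) ^ 2)) + (2 + θ) * (1029 * ε₀)) - (1 + θ⁻¹) * ((2 * (8640 * (((F.L : ℝ) ^ s) ^ 2)⁻¹) + 2 * κP ^ 2 * (cR + 1029 * ε₀)) + ((a₀ *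 (c₀ / cB) * ((F.L : ℝ) ^ (K - n)) ^ 3) * (4320 * (((F.L : ℝ) ^ (K - n)) ^ 2 * (2880 / ((F.L : ℝ) ^ s * (F.L : ℝ) ^ (K - n)) ^ 2)) * (cB / (c₀ * ((F.L : ℝ) ^ (K - n)) ^ (F.P K).d)))))) / (1 + θ + (1 + θ⁻¹) * (2 * κP ^ 2 + 0))) * ‖A‖ ^ 2
        ≤ (RCLike.re ⟪A, DeltaEta F n K c₀ U₀ A⟫_ℂ + ‖projR (covLapSite F n K c₀ U₀) QU (DstarL2 F n K c₀ U₀ A)‖ ^ 2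
        + (a₀ * (c₀ / cB) * ((F.L : ℝ) ^ (K - n)) ^ 3) * ‖Qk F n K h c₀ cB U₀ A‖ ^ 2) := by
  have hc₀ : 0 < c₀ := Fact.out
  have hcB : 0 < cB := Fact.out
  obtain ⟨Zc, χ, M, N₂, N₃, hχ01, hsqZ, hsq, hoff, hsupp, hcard, hlip, hfam, hM, hN₂, hN₃, hMsum, hN₂sum, hN₃sum, hDcomm, hDstarcomm⟩ :=
    exists_LOD_cutoffs_corner F n K c₀ cB h s hnK hs
  have hfamU : ∀ (x : Site (F.P K) 0) (μ : Fin (F.P K).d), ∑ c : Site (F.P K) 0, (χ c (x.shift μ) - χ c x) ^ 2 ≤ (2880 / ((F.L : ℝ) ^ s * (F.L : ℝ) ^ (K - n)) ^ 2) :=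
    sum_sq_sub_univ_le F hoff (fun x μ => (hfam x μ).1)
  have ha : 0 ≤ (a₀ * (c₀ / cB) * ((F.L : ℝ) ^ (K - n)) ^ 3) := by positivity
  -- (H) hq₁ — w7
  have hq₁ := sum_re_inner_DeltaEta_cutoffOps_le F n K c₀ hε₀.le U₀ hreg M χ hM hsq hfamU hθ
  -- (K2a) hKD — px17, with the constant as a square
  have hCD : (0 : ℝ) ≤ 8640 * (((F.L : ℝ) ^ s) ^ 2)⁻¹ := by positivity
  have hKD : ∀ f : BondL2K ℂ 3 (periodsT3 F K) c₀ W₂,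
      ∑ c : Site (F.P K) 0, ‖DstarL2 F n K c₀ U₀ (M c f) - N₂ c (DstarL2 F n K c₀ U₀ f)‖ ^ 2 ≤ Real.sqrt (8640 * (((F.L : ℝ) ^ s) ^ 2)⁻¹) ^ 2 * ‖f‖ ^ 2 := by
    intro f; rw [Real.sq_sqrt hCD]; exact sum_normSq_Dstar_comm_le_of_dock F hoff hfam M N₂ hM hN₂ U₀ f
  -- (K2b) hKP — displayed, at this family
  have hKP' := hKP χ N₂ hN₂ hfamU
  -- (K2e) hν — almost-positivity
  have hν : ∀ A : BondL2K ℂ 3 (periodsT3 F K) c₀ W₂, -(1029 * ε₀ * ‖A‖ ^ 2) ≤ RCLike.re ⟪A, DeltaEta F n K c₀ U₀ A⟫_ℂ := by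
    intro A
    obtain ⟨X, rfl⟩ := (toL2 F K c₀).surjective A
    exact re_inner_DeltaEta_toL2_ge hε₀.le U₀ hreg X
  -- (K2) the knit of w5
  have hK2 := hK2_of_rows (h := h) (cB := cB) U₀ QU ha M (fun c => ⇑(N₂ c)) hKD hKP' hDst hν
  have hC₂ : (0 : ℝ) ≤ (2 * (8640 * (((F.L : ℝ) ^ s) ^ 2)⁻¹) + 2 * κP ^ 2 * (cR + 1029 * ε₀)) := by positivity
  have hK₂ : ∀ A : BondL2K ℂ 3 (periodsT3 F K) c₀ W₂, ∑ c : Site (F.P K) 0, ‖projR (covLapSite F n K c₀ U₀) QU (DstarL2 F n K c₀ U₀ (M c A)) - N₂ c (projR (covLapSite F n K c₀ U₀) QU (DstarL2 F n K c₀ U₀ A))‖ ^ 2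
      ≤ Real.sqrt (2 * (8640 * (((F.L : ℝ) ^ s) ^ 2)⁻¹) + 2 * κP ^ 2 * (cR + 1029 * ε₀)) ^ 2 * ‖A‖ ^ 2 + (2 * κP ^ 2) * (RCLike.re ⟪A, DeltaEta F n K c₀ U₀ A⟫_ℂ + ‖projR (covLapSite F n K c₀ U₀) QU (DstarL2 F n K c₀ U₀ A)‖ ^ 2
        + (a₀ * (c₀ / cB) * ((F.L : ℝ) ^ (K - n)) ^ 3) * ‖Qk F n K h c₀ cB U₀ A‖ ^ 2) := by
    intro A
    have h2 := hK2 A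
    rw [Real.sq_sqrt hCD] at h2
    rw [Real.sq_sqrt hC₂]
    exact h2
  -- (K3) routeR-w4
  have hB : (0 : ℝ) ≤ (2880 / ((F.L : ℝ) ^ s * (F.L : ℝ) ^ (K - n)) ^ 2) := by positivity
  have hC₃ : (0 : ℝ) ≤ ((a₀ * (c₀ / cB) * ((F.L : ℝ) ^ (K - n)) ^ 3) * (4320 * (((F.L : ℝ) ^ (K - n)) ^ 2 * (2880 / ((F.L : ℝ) ^ s * (F.L : ℝ) ^ (K - n)) ^ 2)) * (cB / (c₀ * ((F.L : ℝ) ^ (K - n)) ^ (F.P K).d)))) := by positivity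
  have hK₃ : ∀ A : BondL2K ℂ 3 (periodsT3 F K) c₀ W₂, (a₀ * (c₀ / cB) * ((F.L : ℝ) ^ (K - n)) ^ 3) * ∑ c : Site (F.P K) 0, ‖Qk F n K h c₀ cB U₀ (M c A) - N₃ c (Qk F n K h c₀ cB U₀ A)‖ ^ 2
      ≤ Real.sqrt ((a₀ * (c₀ / cB) * ((F.L : ℝ) ^ (K - n)) ^ 3) * (4320 * (((F.L : ℝ) ^ (K - n)) ^ 2 * (2880 / ((F.L : ℝ) ^ s * (F.L : ℝ) ^ (K - n)) ^ 2)) * (cB / (c₀ * ((F.L : ℝ) ^ (K - n)) ^ (F.P K).d)))) ^ 2 * ‖A‖ ^ 2 + 0 * (RCLike.re ⟪A, DeltaEta F n K c₀ U₀ A⟫_ℂ + ‖projR (covLapSite F n K c₀ U₀) QU (DstarL2 F n K c₀ U₀ A)‖ ^ 2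
        + (a₀ * (c₀ / cB) * ((F.L : ℝ) ^ (K - n)) ^ 3) * ‖Qk F n K h c₀ cB U₀ A‖ ^ 2) := by
    intro A
    rw [Real.sq_sqrt hC₃]
    exact hK3_of_readings F n K h c₀ cB hε₀ hε hε12 U₀ hreg Finset.univ χ hB (fun x μ => hfamU x μ) M N₃ hM hN₃ ha _ A
  -- the ∃-form of the intertwiner property of `QU`
  have hseq₀ : ∀ lam : Site (F.P K) 0 → Matrix (Fin 2) (Fin 2) ℂ, ∃ ns : (j : ℕ) → Site (F.P K) j → Matrix (Fin 2) (Fin 2) ℂ, ns 0 = lam ∧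
      (∀ (j : ℕ) (y : Site (F.P K) (j + 1)), ns (j + 1) y = ns j (emb y) - meanCLM (Idx (F.P K)) (Matrix (Fin 2) (Fin 2) ℂ) fun i : Idx (F.P K) =>
          ns j (emb y) - ((holT (emlIterU j (bgUnits F K U₀)) (emb y) (stairWord i.2.1 (off i.1)) : (Matrix (Fin 2) (Fin 2) ℂ)ˣ) : Matrix (Fin 2) (Fin 2) ℂ) *
            ns j (transl (emb y) (disp (stairWord i.2.1 (off i.1)))) * (((holT (emlIterU j (bgUnits F K U₀)) (emb y) (stairWord i.2.1 (off i.1)))⁻¹ : (Matrix (Fin 2) (Fin 2) ℂ)ˣ) : Matrix (Fin 2) (Fin 2) ℂ)) ∧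
      ns (K - n) = QU (toL2S F K c₀ lam) := by
    intro lam
    obtain ⟨N, hN0, hNs⟩ := exists_linear_avgSeq (P := F.P K) (𝔸 := Matrix (Fin 2) (Fin 2) ℂ)
      (fun j y i => holT (emlIterU j (bgUnits F K U₀)) (emb y) (stairWord i.2.1 (off i.1)))
    exact ⟨fun j => N j lam, hN0 lam, fun j y => hNs j lam y, htop lam (fun j => N j lam) (hN0 lam) (fun j y => hNs j lam y)⟩
  -- the cube isometries Φ_c = Ad_(axialT U₀ c)
  let Φ : Site (F.P K) 0 → BondL2K ℂ 3 (periodsT3 F K) c₀ W₂ → BondL2K ℂ 3 (periodsT3 F K) c₀ W₂ := fun c B =>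
    toL2 F K c₀ (fun b => ((axialT U₀ c b.src : Matrix.specialUnitaryGroup (Fin 2) ℂ) : Matrix (Fin 2) (Fin 2) ℂ) * (toL2 F K c₀).symm B b * star ((axialT U₀ c b.src : Matrix.specialUnitaryGroup (Fin 2) ℂ) : Matrix (Fin 2) (Fin 2) ℂ))
  have hΦ : ∀ (c : Site (F.P K) 0) (A : BondL2K ℂ 3 (periodsT3 F K) c₀ W₂), ‖Φ c (M c A)‖ = ‖M c A‖ := by
    intro c A
    show ‖toL2 F K c₀ (fun b => ((axialT U₀ c b.src : Matrix.specialUnitaryGroup (Fin 2) ℂ) : Matrix (Fin 2) (Fin 2) ℂ) * (toL2 F K c₀).symm (M c A) b * star ((axialT U₀ c b.src : Matrix.specialUnitaryGroup (Fin 2) ℂ) : Matrix (Fin 2) (Fin 2) ℂ))‖ = ‖M c A‖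
    rw [norm_toL2_conj_eq, LinearEquiv.apply_symm_apply]
  -- (C) the per-cube comparison — routeR-w3∕w4
  have hcmp : ∀ (c : Site (F.P K) 0) (A : BondL2K ℂ 3 (periodsT3 F K) c₀ W₂),
      (1 - (3 * θc + δP)) * (RCLike.re ⟪Φ c (M c A), DeltaEta F n K c₀ 1 (Φ c (M c A))⟫_ℂ
        + ‖projR (covLapSite F n K c₀ (1 : GaugeField (F.P K) 0 (Matrix.specialUnitaryGroup (Fin 2) ℂ))) Q1 (DstarL2 F n K c₀ 1 (Φ c (M c A)))‖ ^ 2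
        + (a₀ * (c₀ / cB) * ((F.L : ℝ) ^ (K - n)) ^ 3) * ‖Qk F n K h c₀ cB 1 (Φ c (M c A))‖ ^ 2)
        - (((1 + θc⁻¹) * (16 * ((eta F n K)⁻¹) ^ 2 * (2 * regThreshold F n K ε₀ * ((((3 * (F.L ^ s * F.L ^ (K - n))) : ℕ) : ℝ) + 7 * (F.L : ℝ) ^ (K - n))) ^ 2) + (1 + θc) * (1029 * ε₀)) + (1 + θc⁻¹) * (12 * ((eta F n K)⁻¹) ^ 2 * (2 * regThreshold F n K ε₀ * ((((3 * (F.L ^ s * F.L ^ (K - n))) : ℕ) : ℝ) + 7 * (F.L : ℝ) ^ (K - n))) ^ 2)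
            + (1 + θc⁻¹) * (12 * ((eta F n K)⁻¹) ^ 2 * (2 * regThreshold F n K ε₀ * ((((3 * (F.L ^ s * F.L ^ (K - n))) : ℕ) : ℝ) + 7 * (F.L : ℝ) ^ (K - n))) ^ 2) + (a₀ * (c₀ / cB) * ((F.L : ℝ) ^ (K - n)) ^ 3) * ((1 + θc⁻¹) * (4 * (3 * 10 ^ 10 * (F.L : ℝ) ^ 10 * ε₀ ^ 2 + 192 * ((F.L : ℝ) ^ (K - n) * (2 * regThreshold F n K ε₀ * ((((3 * (F.L ^ s * F.L ^ (K - n))) : ℕ) : ℝ) + 7 * (F.L : ℝ) ^ (K - n)))) ^ 2) * (cB / (c₀ * ((F.L : ℝ) ^ (K - n)) ^ (F.P K).d)))) + (2 * θc + δP) * c₆) * ‖M c A‖ ^ 2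
      ≤ (RCLike.re ⟪(M c A), DeltaEta F n K c₀ U₀ (M c A)⟫_ℂ + ‖projR (covLapSite F n K c₀ U₀) QU (DstarL2 F n K c₀ U₀ (M c A))‖ ^ 2
        + (a₀ * (c₀ / cB) * ((F.L : ℝ) ^ (K - n)) ^ 3) * ‖Qk F n K h c₀ cB U₀ (M c A)‖ ^ 2) := by
    intro c A
    obtain ⟨Qc, hseqc, hlocc⟩ := hloc c
    set X : PBond (F.P K) 0 → Matrix (Fin 2) (Fin 2) ℂ := (toL2 F K c₀).symm (M c A) with hXdef
    have hMX : M c A = toL2 F K c₀ X := ((toL2 F K c₀).apply_symm_apply (M c A)).symm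
    have hXsupp : ∀ b : PBond (F.P K) 0, X b ≠ 0 → Site.tdist c b.src ≤ (3 * (F.L ^ s * F.L ^ (K - n))) := by
      have hfun : X = fun b' : PBond (F.P K) 0 => χ c b'.src • (toL2 F K c₀).symm A b' := by
        funext b; exact hM c A b
      rw [hfun]
      exact tdist_le_of_hsupp F n K s χ hsupp c ((toL2 F K c₀).symm A)
    have key := localComparison_of_cube_cubeGauge F h c₀ cB hε₀ hε hε12 c U₀ hreg QU hseq₀ Qc hseqc Q1 X hXsupp hwrap hδP hθc hsmall ha
      (hlocc X hXsupp) (hP1abs _)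
    have hΦX : Φ c (M c A) = (toL2 F K c₀ (fun b => ((axialT U₀ c b.src : Matrix.specialUnitaryGroup (Fin 2) ℂ) : Matrix (Fin 2) (Fin 2) ℂ) * X b * star ((axialT U₀ c b.src : Matrix.specialUnitaryGroup (Fin 2) ℂ) : Matrix (Fin 2) (Fin 2) ℂ))) := rfl
    rw [hΦX, hMX]
    exact key
  -- THE KNIT (w5 ✓p753786 §3)
  have hθ' : 3 * θc + δP ≤ 1 := hsmall
  have hμ : (0 : ℝ) ≤ 2 * κP ^ 2 + 0 := by positivity
  have key := curvedTarget_of_LOD_topMean U₀ QU ha₀ Q1 htop₁ hker₁ (J := Site (F.P K) 0) M (fun c => ⇑(N₂ c)) N₃ Φ hθ hθ' hμ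
    hMsum (fun y => (hN₂sum y).le) (fun z => (hN₃sum z).le) hq₁ hK₂ hK₃ hΦ hcmp
  intro A
  have hA := key A
  rw [Real.sq_sqrt hC₂, Real.sq_sqrt hC₃] at hA
  exact hA


/-- ★★★ **(L6) THE CURVED TARGET AT THE MEMBER, CLOSED-FORM COEFFICIENT** — `curvedTarget_member_raw` with every `η⁻¹ = L^{K−n}`, `regThreshold = ε₀L^{−2(K−n)}`, `(F.P K).d = 3`
cancelled (`field_simp; ring`): the coefficient of `‖A‖²` is a function of `L, s, ε₀, a₀, θ, θc, δP, κP, cR, c₆` ONLY — the body of the `hT` binder of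
✓`gaugeFixedRow_of_curvedTarget_of_le` at this member and this `Q″`, modulo the four displayed rows.  CONDITIONAL; the window `γ > 0` is NOT asserted.
[cite: Balaban1985BackgroundPropagators, (3.49) p.399, Thm 3.11 p.416, (3.118)-(3.122) pp.419-420; Balaban1984PropagatorsI, Prop. 1.1 (1.90) p.33] -/
theorem curvedTarget_member (F : T3Family) {n K : ℕ} (h : n ≤ K) (c₀ cB : ℝ) [Fact (0 < c₀)] [Fact (0 < cB)]
    {ε₀ : ℝ} (hε₀ : 0 < ε₀) (hε : 10 ^ 10 * (F.L : ℝ) ^ 6 * ε₀ ≤ 1) (hε12 : 10 ^ 12 * (F.L : ℝ) ^ 3 * ε₀ ≤ 1)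
    (U₀ : GaugeField (F.P K) 0 (Matrix.specialUnitaryGroup (Fin 2) ℂ)) (hreg : RegPr F n K ε₀ U₀)
    (s : ℕ) (hnK : n < K) (hs : s < F.m + n)
    (hwrap : 2 * ((3 * (F.L ^ s * F.L ^ (K - n))) + 8 * (F.P K).L ^ (K - n) + 1) ≤ (F.P K).sitesPerDir 0)
    {a₀ : ℝ} (ha₀ : 0 < a₀)
    (QU : SiteL2K ℂ 3 (periodsT3 F K) c₀ W₂ →ₗ[ℂ] (Site (F.P K) (K - n) → Matrix (Fin 2) (Fin 2) ℂ))
    (htop : ∀ (lam : Site (F.P K) 0 → Matrix (Fin 2) (Fin 2) ℂ) (ns : (j : ℕ) → Site (F.P K) j → Matrix (Fin 2) (Fin 2) ℂ), ns 0 = lam →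
      (∀ (j : ℕ) (y : Site (F.P K) (j + 1)), ns (j + 1) y = ns j (emb y) - meanCLM (Idx (F.P K)) (Matrix (Fin 2) (Fin 2) ℂ) fun i : Idx (F.P K) =>
          ns j (emb y) - ((holT (emlIterU j (bgUnits F K U₀)) (emb y) (stairWord i.2.1 (off i.1)) : (Matrix (Fin 2) (Fin 2) ℂ)ˣ) : Matrix (Fin 2) (Fin 2) ℂ) *
            ns j (transl (emb y) (disp (stairWord i.2.1 (off i.1)))) * (((holT (emlIterU j (bgUnits F K U₀)) (emb y) (stairWord i.2.1 (off i.1)))⁻¹ : (Matrix (Fin 2) (Fin 2) ℂ)ˣ) : Matrix (Fin 2) (Fin 2) ℂ)) →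
      ns (K - n) = QU (toL2S F K c₀ lam))
    (Q1 : SiteL2K ℂ 3 (periodsT3 F K) c₀ W₂ →ₗ[ℂ] (Site (F.P K) (K - n) → Matrix (Fin 2) (Fin 2) ℂ))
    (htop₁ : ∀ (lam : Site (F.P K) 0 → Matrix (Fin 2) (Fin 2) ℂ) (ns : (j : ℕ) → Site (F.P K) j → Matrix (Fin 2) (Fin 2) ℂ), ns 0 = lam →
      (∀ (j : ℕ) (y : Site (F.P K) (j + 1)), ns (j + 1) y = ns j (emb y) - meanCLM (Idx (F.P K)) (Matrix (Fin 2) (Fin 2) ℂ) fun i : Idx (F.P K) =>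
          ns j (emb y) - ((holT (emlIterU j (bgUnits F K (1 : GaugeField (F.P K) 0 (Matrix.specialUnitaryGroup (Fin 2) ℂ)))) (emb y) (stairWord i.2.1 (off i.1)) : (Matrix (Fin 2) (Fin 2) ℂ)ˣ) : Matrix (Fin 2) (Fin 2) ℂ) *
            ns j (transl (emb y) (disp (stairWord i.2.1 (off i.1)))) * (((holT (emlIterU j (bgUnits F K (1 : GaugeField (F.P K) 0 (Matrix.specialUnitaryGroup (Fin 2) ℂ)))) (emb y) (stairWord i.2.1 (off i.1)))⁻¹ : (Matrix (Fin 2) (Fin 2) ℂ)ˣ) : Matrix (Fin 2) (Fin 2) ℂ)) →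
      ns (K - n) = Q1 (toL2S F K c₀ lam))
    (hker₁ : LinearMap.ker Q1 ≤ NS F n K h c₀ cB (1 : GaugeField (F.P K) 0 (Matrix.specialUnitaryGroup (Fin 2) ℂ)))
    {θ θc δP κP cR c₆ : ℝ} (hθ : 0 < θ) (hθc : 0 < θc) (hδP : 0 ≤ δP) (hsmall : 3 * θc + δP ≤ 1) (hcR : 0 ≤ cR)
    (hKP : ∀ (χ : Site (F.P K) 0 → Site (F.P K) 0 → ℝ) (N₂ : Site (F.P K) 0 → (SiteL2K ℂ 3 (periodsT3 F K) c₀ W₂ →ₗ[ℂ] SiteL2K ℂ 3 (periodsT3 F K) c₀ W₂)),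
      (∀ (c : Site (F.P K) 0) (φ : SiteL2K ℂ 3 (periodsT3 F K) c₀ W₂) (x : Site (F.P K) 0), (toL2S F K c₀).symm (N₂ c φ) x = χ c x • (toL2S F K c₀).symm φ x) →
      (∀ (x : Site (F.P K) 0) (μ : Fin (F.P K).d), ∑ c : Site (F.P K) 0, (χ c (x.shift μ) - χ c x) ^ 2 ≤ (2880 / ((F.L : ℝ) ^ s * (F.L : ℝ) ^ (K - n)) ^ 2)) →
      ∀ y : SiteL2K ℂ 3 (periodsT3 F K) c₀ W₂, ∑ c : Site (F.P K) 0, ‖projR (covLapSite F n K c₀ U₀) QU (N₂ c y) - N₂ c (projR (covLapSite F n K c₀ U₀) QU y)‖ ^ 2 ≤ κP ^ 2 * ‖y‖ ^ 2)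
    (hDst : ∀ A : BondL2K ℂ 3 (periodsT3 F K) c₀ W₂, ‖DstarL2 F n K c₀ U₀ A‖ ^ 2 ≤ ‖projR (covLapSite F n K c₀ U₀) QU (DstarL2 F n K c₀ U₀ A)‖ ^ 2 + cR * ‖A‖ ^ 2)
    (hloc : ∀ c : Site (F.P K) 0, ∃ Qc : SiteL2K ℂ 3 (periodsT3 F K) c₀ W₂ →ₗ[ℂ] (Site (F.P K) (K - n) → Matrix (Fin 2) (Fin 2) ℂ),
      (∀ lam : Site (F.P K) 0 → Matrix (Fin 2) (Fin 2) ℂ, ∃ ns : (j : ℕ) → Site (F.P K) j → Matrix (Fin 2) (Fin 2) ℂ, ns 0 = lam ∧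
        (∀ (j : ℕ) (y : Site (F.P K) (j + 1)), ns (j + 1) y = ns j (emb y) - meanCLM (Idx (F.P K)) (Matrix (Fin 2) (Fin 2) ℂ) fun i : Idx (F.P K) =>
          ns j (emb y) - ((holT (emlIterU j (bgUnits F K (GaugeField.gaugeAct (axialT U₀ c) U₀))) (emb y) (stairWord i.2.1 (off i.1)) : (Matrix (Fin 2) (Fin 2) ℂ)ˣ) : Matrix (Fin 2) (Fin 2) ℂ) *
            ns j (transl (emb y) (disp (stairWord i.2.1 (off i.1)))) * (((holT (emlIterU j (bgUnits F K (GaugeField.gaugeAct (axialT U₀ c) U₀))) (emb y) (stairWord i.2.1 (off i.1)))⁻¹ : (Matrix (Fin 2) (Fin 2) ℂ)ˣ) : Matrix (Fin 2) (Fin 2) ℂ)) ∧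
        ns (K - n) = Qc (toL2S F K c₀ lam)) ∧
      ∀ X : PBond (F.P K) 0 → Matrix (Fin 2) (Fin 2) ℂ, (∀ b : PBond (F.P K) 0, X b ≠ 0 → Site.tdist c b.src ≤ (3 * (F.L ^ s * F.L ^ (K - n)))) →
        ‖⟪DstarL2 F n K c₀ (GaugeField.gaugeAct (axialT U₀ c) U₀) (toL2 F K c₀ (fun b => ((axialT U₀ c b.src : Matrix.specialUnitaryGroup (Fin 2) ℂ) : Matrix (Fin 2) (Fin 2) ℂ) * X b * star ((axialT U₀ c b.src : Matrix.specialUnitaryGroup (Fin 2) ℂ) : Matrix (Fin 2) (Fin 2) ℂ))),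
            (DstarL2 F n K c₀ (GaugeField.gaugeAct (axialT U₀ c) U₀) (toL2 F K c₀ (fun b => ((axialT U₀ c b.src : Matrix.specialUnitaryGroup (Fin 2) ℂ) : Matrix (Fin 2) (Fin 2) ℂ) * X b * star ((axialT U₀ c b.src : Matrix.specialUnitaryGroup (Fin 2) ℂ) : Matrix (Fin 2) (Fin 2) ℂ))) - projR (covLapSite F n K c₀ (GaugeField.gaugeAct (axialT U₀ c) U₀)) Qc (DstarL2 F n K c₀ (GaugeField.gaugeAct (axialT U₀ c) U₀) (toL2 F K c₀ (fun b => ((axialT U₀ c b.src : Matrix.specialUnitaryGroup (Fin 2) ℂ) : Matrix (Fin 2) (Fin 2) ℂ) * X b * star ((axialT U₀ c b.src : Matrix.specialUnitaryGroup (Fin 2) ℂ) : Matrix (Fin 2) (Fin 2) ℂ)))))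
            - (DstarL2 F n K c₀ (GaugeField.gaugeAct (axialT U₀ c) U₀) (toL2 F K c₀ (fun b => ((axialT U₀ c b.src : Matrix.specialUnitaryGroup (Fin 2) ℂ) : Matrix (Fin 2) (Fin 2) ℂ) * X b * star ((axialT U₀ c b.src : Matrix.specialUnitaryGroup (Fin 2) ℂ) : Matrix (Fin 2) (Fin 2) ℂ))) - projR (covLapSite F n K c₀ 1) Q1 (DstarL2 F n K c₀ (GaugeField.gaugeAct (axialT U₀ c) U₀) (toL2 F K c₀ (fun b => ((axialT U₀ c b.src : Matrix.specialUnitaryGroup (Fin 2) ℂ) : Matrix (Fin 2) (Fin 2) ℂ) * X b * star ((axialT U₀ c b.src : Matrix.specialUnitaryGroup (Fin 2) ℂ) : Matrix (Fin 2) (Fin 2) ℂ)))))⟫_ℂ‖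
          ≤ δP * ‖DstarL2 F n K c₀ (GaugeField.gaugeAct (axialT U₀ c) U₀) (toL2 F K c₀ (fun b => ((axialT U₀ c b.src : Matrix.specialUnitaryGroup (Fin 2) ℂ) : Matrix (Fin 2) (Fin 2) ℂ) * X b * star ((axialT U₀ c b.src : Matrix.specialUnitaryGroup (Fin 2) ℂ) : Matrix (Fin 2) (Fin 2) ℂ)))‖ ^ 2)
    (hP1abs : ∀ Y : PBond (F.P K) 0 → Matrix (Fin 2) (Fin 2) ℂ, ‖DstarL2 F n K c₀ 1 (toL2 F K c₀ Y)‖ ^ 2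
      ≤ ‖projR (covLapSite F n K c₀ 1) Q1 (DstarL2 F n K c₀ 1 (toL2 F K c₀ Y))‖ ^ 2 + c₆ * ‖toL2 F K c₀ Y‖ ^ 2) :
    ∀ A : BondL2K ℂ 3 (periodsT3 F K) c₀ W₂,
      (((1 - (3 * θc + δP)) * (1 / (4 * B5Prop11Plancherel.Cst 3 a₀)) - ((1 + θc⁻¹) * (160 * ε₀ ^ 2 * (3 * (F.L : ℝ) ^ s + 7) ^ 2) + (1 + θc) * (1029 * ε₀) + a₀ * ((1 + θc⁻¹) * (4 * (3 * 10 ^ 10 * (F.L : ℝ) ^ 10 * ε₀ ^ 2 + 768 * ε₀ ^ 2 * (3 * (F.L : ℝ) ^ s + 7) ^ 2))) + (2 * θc + δP) * c₆)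
        - ((1 + θ⁻¹) * (11520 * (((F.L : ℝ) ^ s) ^ 2)⁻¹) + (2 + θ) * (1029 * ε₀))
        - ((1 + θ⁻¹) * ((17280 * (((F.L : ℝ) ^ s) ^ 2)⁻¹ + 2 * κP ^ 2 * (cR + 1029 * ε₀)) + 12441600 * a₀ * (((F.L : ℝ) ^ s) ^ 2)⁻¹)))
       / (1 + θ + (1 + θ⁻¹) * (2 * κP ^ 2))) * ‖A‖ ^ 2
        ≤ (RCLike.re ⟪A, DeltaEta F n K c₀ U₀ A⟫_ℂ + ‖projR (covLapSite F n K c₀ U₀) QU (DstarL2 F n K c₀ U₀ A)‖ ^ 2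
        + (a₀ * (c₀ / cB) * ((F.L : ℝ) ^ (K - n)) ^ 3) * ‖Qk F n K h c₀ cB U₀ A‖ ^ 2) := by
  intro A
  have hraw := curvedTarget_member_raw F h c₀ cB hε₀ hε hε12 U₀ hreg s hnK hs hwrap ha₀ QU htop Q1 htop₁ hker₁ hθ hθc hδP hsmall hcR hKP hDst hloc hP1abs A
  have hL : (0 : ℝ) < F.L := by have := F.hL.2; exact_mod_cast (by omega : 0 < F.L)
  have hc₀ : 0 < c₀ := Fact.out
  have hcB : 0 < cB := Fact.out
  have hCst : 0 < B5Prop11Plancherel.Cst 3 a₀ := lt_of_lt_of_le one_pos (B5Prop11Lower.one_le_Cst a₀)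
  have hη : (eta F n K)⁻¹ = (F.L : ℝ) ^ (K - n) := by rw [T3SectALandauChart.eta, ← inv_pow, inv_inv]
  have hrt : regThreshold F n K ε₀ = ε₀ * (((F.L : ℝ) ^ (K - n)) ^ 2)⁻¹ := by
    rw [T3RegularMinimiser.regThreshold, mul_comm 2 (K - n), pow_mul, inv_pow, inv_pow]
  have hd : (F.P K).d = 3 := T3Family.P_d F K
  have hγ : (((1 - (3 * θc + δP)) * (1 / (4 * B5Prop11Plancherel.Cst 3 a₀)) - ((1 + θc⁻¹) * (160 * ε₀ ^ 2 * (3 * (F.L : ℝ) ^ s + 7) ^ 2) + (1 + θc) * (1029 * ε₀) + a₀ * ((1 + θc⁻¹) * (4 * (3 * 10 ^ 10 * (F.L : ℝ) ^ 10 * ε₀ ^ 2 + 768 * ε₀ ^ 2 * (3 * (F.L : ℝ) ^ s + 7) ^ 2))) + (2 * θc + δP) * c₆)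
        - ((1 + θ⁻¹) * (11520 * (((F.L : ℝ) ^ s) ^ 2)⁻¹) + (2 + θ) * (1029 * ε₀))
        - ((1 + θ⁻¹) * ((17280 * (((F.L : ℝ) ^ s) ^ 2)⁻¹ + 2 * κP ^ 2 * (cR + 1029 * ε₀)) + 12441600 * a₀ * (((F.L : ℝ) ^ s) ^ 2)⁻¹)))
       / (1 + θ + (1 + θ⁻¹) * (2 * κP ^ 2)))
      = (((1 - (3 * θc + δP)) * (1 / (4 * B5Prop11Plancherel.Cst 3 a₀)) - (((1 + θc⁻¹) * (16 * ((eta F n K)⁻¹) ^ 2 * (2 * regThreshold F n K ε₀ * ((((3 * (F.L ^ s * F.L ^ (K - n))) : ℕ) : ℝ) + 7 * (F.L : ℝ) ^ (K - n))) ^ 2) + (1 + θc) * (1029 * ε₀)) + (1 + θc⁻¹) * (12 * ((eta F n K)⁻¹) ^ 2 * (2 * regThreshold F n K ε₀ * ((((3 * (F.L ^ s * F.L ^ (K - n))) : ℕ) : ℝ) + 7 * (F.L : ℝ) ^ (K - n))) ^ 2)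
            + (1 + θc⁻¹) * (12 * ((eta F n K)⁻¹) ^ 2 * (2 * regThreshold F n K ε₀ * ((((3 * (F.L ^ s * F.L ^ (K - n))) : ℕ) : ℝ) + 7 * (F.L : ℝ) ^ (K - n))) ^ 2) + (a₀ * (c₀ / cB) * ((F.L : ℝ) ^ (K - n)) ^ 3) * ((1 + θc⁻¹) * (4 * (3 * 10 ^ 10 * (F.L : ℝ) ^ 10 * ε₀ ^ 2 + 192 * ((F.L : ℝ) ^ (K - n) * (2 * regThreshold F n K ε₀ * ((((3 * (F.L ^ s * F.L ^ (K - n))) : ℕ) : ℝ) + 7 * (F.L : ℝ) ^ (K - n)))) ^ 2) * (cB / (c₀ * ((F.L : ℝ) ^ (K - n)) ^ (F.P K).d)))) + (2 * θc + δP) * c₆) - ((1 + θ⁻¹) * (4 * ((eta F n K)⁻¹) ^ 2 * (2880 / ((F.L : ℝ) ^ s * (F.L : ℝ) ^ (K - n)) ^ 2)) + (2 + θ) * (1029 * ε₀)) - (1 + θ⁻¹) * ((2 * (8640 * (((F.L : ℝ) ^ s) ^ 2)⁻¹) + 2 * κP ^ 2 * (cR + 1029 * ε₀)) + ((a₀ *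 (c₀ / cB) * ((F.L : ℝ) ^ (K - n)) ^ 3) * (4320 * (((F.L : ℝ) ^ (K - n)) ^ 2 * (2880 / ((F.L : ℝ) ^ s * (F.L : ℝ) ^ (K - n)) ^ 2)) * (cB / (c₀ * ((F.L : ℝ) ^ (K - n)) ^ (F.P K).d)))))) / (1 + θ + (1 + θ⁻¹) * (2 * κP ^ 2 + 0))) := by
    rw [hη, hrt, hd]
    push_cast
    have hℓ : (0 : ℝ) < (F.L : ℝ) ^ (K - n) := by positivity
    have hLs : (0 : ℝ) < (F.L : ℝ) ^ s := by positivity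
    field_simp
    ring
  rw [hγ]
  exact hraw


/-! ## §3 v1.1 — (K2d) `hDst` and `hP1abs` DISCHARGED by routeR-w4 g27's ✓`Prop7DivergenceAbsorptionOfRegPr` (✓p758760): two member rows left -/

/-- ★★★ **(L6) THE CURVED TARGET AT THE MEMBER FROM TWO DISPLAYED ROWS `hKP`, `hloc`** — `curvedTarget_member` with (K2d) `hDst` := ✓`normSq_DstarL2_le_normSq_projR_add_of_regPr'`
(at `RegPr`, `10⁷L³ε₀ ≤ 1` from `10¹²L³ε₀ ≤ 1`) and `hP1abs` := ✓`normSq_DstarL2_one_le_normSq_projR_add` (at `U₀ = 1`), both at the coarse weight `c₁ := c₀·(L³)^{K−n}` (chair's pin (2)) and a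
free massive mass `am > 0`, so that `cR = c₆ = ((2∕((1 + 25∕8)(600(27∕4)⁶ + am)))²·am)⁻¹` — K-FREE (minimal ≈ 9.6·10⁸ at `am = 600(27∕4)⁶`).  CONDITIONAL on `hKP`, `hloc`; window not asserted.
[cite: Balaban1985BackgroundPropagators, (3.21)-(3.27) pp.394-395, (3.49) p.399, Thm 3.11 p.416; Balaban1984PropagatorsI, Prop. 1.1 (1.90) p.33] -/
theorem curvedTarget_member_of_hKP_hloc (F : T3Family) {n K : ℕ} (h : n ≤ K) (c₀ cB : ℝ) [Fact (0 < c₀)] [Fact (0 < cB)]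
    {ε₀ : ℝ} (hε₀ : 0 < ε₀) (hε : 10 ^ 10 * (F.L : ℝ) ^ 6 * ε₀ ≤ 1) (hε12 : 10 ^ 12 * (F.L : ℝ) ^ 3 * ε₀ ≤ 1)
    (U₀ : GaugeField (F.P K) 0 (Matrix.specialUnitaryGroup (Fin 2) ℂ)) (hreg : RegPr F n K ε₀ U₀)
    (s : ℕ) (hnK : n < K) (hs : s < F.m + n)
    (hwrap : 2 * ((3 * (F.L ^ s * F.L ^ (K - n))) + 8 * (F.P K).L ^ (K - n) + 1) ≤ (F.P K).sitesPerDir 0)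
    {a₀ : ℝ} (ha₀ : 0 < a₀)
    (QU : SiteL2K ℂ 3 (periodsT3 F K) c₀ W₂ →ₗ[ℂ] (Site (F.P K) (K - n) → Matrix (Fin 2) (Fin 2) ℂ))
    (htop : ∀ (lam : Site (F.P K) 0 → Matrix (Fin 2) (Fin 2) ℂ) (ns : (j : ℕ) → Site (F.P K) j → Matrix (Fin 2) (Fin 2) ℂ), ns 0 = lam →
      (∀ (j : ℕ) (y : Site (F.P K) (j + 1)), ns (j + 1) y = ns j (emb y) - meanCLM (Idx (F.P K)) (Matrix (Fin 2) (Fin 2) ℂ) fun i : Idx (F.P K) =>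
          ns j (emb y) - ((holT (emlIterU j (bgUnits F K U₀)) (emb y) (stairWord i.2.1 (off i.1)) : (Matrix (Fin 2) (Fin 2) ℂ)ˣ) : Matrix (Fin 2) (Fin 2) ℂ) *
            ns j (transl (emb y) (disp (stairWord i.2.1 (off i.1)))) * (((holT (emlIterU j (bgUnits F K U₀)) (emb y) (stairWord i.2.1 (off i.1)))⁻¹ : (Matrix (Fin 2) (Fin 2) ℂ)ˣ) : Matrix (Fin 2) (Fin 2) ℂ)) →
      ns (K - n) = QU (toL2S F K c₀ lam))
    (Q1 : SiteL2K ℂ 3 (periodsT3 F K) c₀ W₂ →ₗ[ℂ] (Site (F.P K) (K - n) → Matrix (Fin 2) (Fin 2) ℂ))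
    (htop₁ : ∀ (lam : Site (F.P K) 0 → Matrix (Fin 2) (Fin 2) ℂ) (ns : (j : ℕ) → Site (F.P K) j → Matrix (Fin 2) (Fin 2) ℂ), ns 0 = lam →
      (∀ (j : ℕ) (y : Site (F.P K) (j + 1)), ns (j + 1) y = ns j (emb y) - meanCLM (Idx (F.P K)) (Matrix (Fin 2) (Fin 2) ℂ) fun i : Idx (F.P K) =>
          ns j (emb y) - ((holT (emlIterU j (bgUnits F K (1 : GaugeField (F.P K) 0 (Matrix.specialUnitaryGroup (Fin 2) ℂ)))) (emb y) (stairWord i.2.1 (off i.1)) : (Matrix (Fin 2) (Fin 2) ℂ)ˣ) : Matrix (Fin 2) (Fin 2) ℂ) *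
            ns j (transl (emb y) (disp (stairWord i.2.1 (off i.1)))) * (((holT (emlIterU j (bgUnits F K (1 : GaugeField (F.P K) 0 (Matrix.specialUnitaryGroup (Fin 2) ℂ)))) (emb y) (stairWord i.2.1 (off i.1)))⁻¹ : (Matrix (Fin 2) (Fin 2) ℂ)ˣ) : Matrix (Fin 2) (Fin 2) ℂ)) →
      ns (K - n) = Q1 (toL2S F K c₀ lam))
    (hker₁ : LinearMap.ker Q1 ≤ NS F n K h c₀ cB (1 : GaugeField (F.P K) 0 (Matrix.specialUnitaryGroup (Fin 2) ℂ)))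
    {θ θc δP κP am : ℝ} (hθ : 0 < θ) (hθc : 0 < θc) (hδP : 0 ≤ δP) (hsmall : 3 * θc + δP ≤ 1) (ham : 0 < am)
    (hKP : ∀ (χ : Site (F.P K) 0 → Site (F.P K) 0 → ℝ) (N₂ : Site (F.P K) 0 → (SiteL2K ℂ 3 (periodsT3 F K) c₀ W₂ →ₗ[ℂ] SiteL2K ℂ 3 (periodsT3 F K) c₀ W₂)),
      (∀ (c : Site (F.P K) 0) (φ : SiteL2K ℂ 3 (periodsT3 F K) c₀ W₂) (x : Site (F.P K) 0), (toL2S F K c₀).symm (N₂ c φ) x = χ c x • (toL2S F K c₀).symm φ x) →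
      (∀ (x : Site (F.P K) 0) (μ : Fin (F.P K).d), ∑ c : Site (F.P K) 0, (χ c (x.shift μ) - χ c x) ^ 2 ≤ (2880 / ((F.L : ℝ) ^ s * (F.L : ℝ) ^ (K - n)) ^ 2)) →
      ∀ y : SiteL2K ℂ 3 (periodsT3 F K) c₀ W₂, ∑ c : Site (F.P K) 0, ‖projR (covLapSite F n K c₀ U₀) QU (N₂ c y) - N₂ c (projR (covLapSite F n K c₀ U₀) QU y)‖ ^ 2 ≤ κP ^ 2 * ‖y‖ ^ 2)
    (hloc : ∀ c : Site (F.P K) 0, ∃ Qc : SiteL2K ℂ 3 (periodsT3 F K) c₀ W₂ →ₗ[ℂ] (Site (F.P K) (K - n) → Matrix (Fin 2) (Fin 2) ℂ),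
      (∀ lam : Site (F.P K) 0 → Matrix (Fin 2) (Fin 2) ℂ, ∃ ns : (j : ℕ) → Site (F.P K) j → Matrix (Fin 2) (Fin 2) ℂ, ns 0 = lam ∧
        (∀ (j : ℕ) (y : Site (F.P K) (j + 1)), ns (j + 1) y = ns j (emb y) - meanCLM (Idx (F.P K)) (Matrix (Fin 2) (Fin 2) ℂ) fun i : Idx (F.P K) =>
          ns j (emb y) - ((holT (emlIterU j (bgUnits F K (GaugeField.gaugeAct (axialT U₀ c) U₀))) (emb y) (stairWord i.2.1 (off i.1)) : (Matrix (Fin 2) (Fin 2) ℂ)ˣ) : Matrix (Fin 2) (Fin 2) ℂ) *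
            ns j (transl (emb y) (disp (stairWord i.2.1 (off i.1)))) * (((holT (emlIterU j (bgUnits F K (GaugeField.gaugeAct (axialT U₀ c) U₀))) (emb y) (stairWord i.2.1 (off i.1)))⁻¹ : (Matrix (Fin 2) (Fin 2) ℂ)ˣ) : Matrix (Fin 2) (Fin 2) ℂ)) ∧
        ns (K - n) = Qc (toL2S F K c₀ lam)) ∧
      ∀ X : PBond (F.P K) 0 → Matrix (Fin 2) (Fin 2) ℂ, (∀ b : PBond (F.P K) 0, X b ≠ 0 → Site.tdist c b.src ≤ (3 * (F.L ^ s * F.L ^ (K - n)))) →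
        ‖⟪DstarL2 F n K c₀ (GaugeField.gaugeAct (axialT U₀ c) U₀) (toL2 F K c₀ (fun b => ((axialT U₀ c b.src : Matrix.specialUnitaryGroup (Fin 2) ℂ) : Matrix (Fin 2) (Fin 2) ℂ) * X b * star ((axialT U₀ c b.src : Matrix.specialUnitaryGroup (Fin 2) ℂ) : Matrix (Fin 2) (Fin 2) ℂ))),
            (DstarL2 F n K c₀ (GaugeField.gaugeAct (axialT U₀ c) U₀) (toL2 F K c₀ (fun b => ((axialT U₀ c b.src : Matrix.specialUnitaryGroup (Fin 2) ℂ) : Matrix (Fin 2) (Fin 2) ℂ) * X b * star ((axialT U₀ c b.src : Matrix.specialUnitaryGroup (Fin 2) ℂ) : Matrix (Fin 2) (Fin 2) ℂ))) - projR (covLapSite F n K c₀ (GaugeField.gaugeAct (axialT U₀ c) U₀)) Qc (DstarL2 F n K c₀ (GaugeField.gaugeAct (axialT U₀ c) U₀) (toL2 F K c₀ (fun b => ((axialT U₀ c b.src : Matrix.specialUnitaryGroup (Fin 2) ℂ) : Matrix (Fin 2) (Fin 2) ℂ) * X b * star ((axialT U₀ c b.src : Matrix.specialUnitaryGroup (Fin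 2) ℂ) : Matrix (Fin 2) (Fin 2) ℂ)))))
            - (DstarL2 F n K c₀ (GaugeField.gaugeAct (axialT U₀ c) U₀) (toL2 F K c₀ (fun b => ((axialT U₀ c b.src : Matrix.specialUnitaryGroup (Fin 2) ℂ) : Matrix (Fin 2) (Fin 2) ℂ) * X b * star ((axialT U₀ c b.src : Matrix.specialUnitaryGroup (Fin 2) ℂ) : Matrix (Fin 2) (Fin 2) ℂ))) - projR (covLapSite F n K c₀ 1) Q1 (DstarL2 F n K c₀ (GaugeField.gaugeAct (axialT U₀ c) U₀) (toL2 F K c₀ (fun b => ((axialT U₀ c b.src : Matrix.specialUnitaryGroup (Fin 2) ℂ) : Matrix (Fin 2) (Fin 2) ℂ) * X b * star ((axialT U₀ c b.src : Matrix.specialUnitaryGroup (Fin 2) ℂ) : Matrix (Fin 2) (Fin 2) ℂ)))))⟫_ℂ‖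
          ≤ δP * ‖DstarL2 F n K c₀ (GaugeField.gaugeAct (axialT U₀ c) U₀) (toL2 F K c₀ (fun b => ((axialT U₀ c b.src : Matrix.specialUnitaryGroup (Fin 2) ℂ) : Matrix (Fin 2) (Fin 2) ℂ) * X b * star ((axialT U₀ c b.src : Matrix.specialUnitaryGroup (Fin 2) ℂ) : Matrix (Fin 2) (Fin 2) ℂ)))‖ ^ 2) :
    ∀ A : BondL2K ℂ 3 (periodsT3 F K) c₀ W₂,
      (((1 - (3 * θc + δP)) * (1 / (4 * B5Prop11Plancherel.Cst 3 a₀)) - ((1 + θc⁻¹) * (160 * ε₀ ^ 2 * (3 * (F.L : ℝ) ^ s + 7) ^ 2) + (1 + θc) * (1029 * ε₀) + a₀ * ((1 + θc⁻¹) * (4 * (3 * 10 ^ 10 * (F.L : ℝ) ^ 10 * ε₀ ^ 2 + 768 * ε₀ ^ 2 * (3 * (F.L : ℝ) ^ s + 7) ^ 2))) + (2 * θc + δP) * ((2 / ((1 + 25 / 8) * (600 * (27 / 4 : ℝ) ^ 6 + am))) ^ 2 * am)⁻¹)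
        - ((1 + θ⁻¹) * (11520 * (((F.L : ℝ) ^ s) ^ 2)⁻¹) + (2 + θ) * (1029 * ε₀))
        - ((1 + θ⁻¹) * ((17280 * (((F.L : ℝ) ^ s) ^ 2)⁻¹ + 2 * κP ^ 2 * (((2 / ((1 + 25 / 8) * (600 * (27 / 4 : ℝ) ^ 6 + am))) ^ 2 * am)⁻¹ + 1029 * ε₀)) + 12441600 * a₀ * (((F.L : ℝ) ^ s) ^ 2)⁻¹)))
       / (1 + θ + (1 + θ⁻¹) * (2 * κP ^ 2))) * ‖A‖ ^ 2
        ≤ (RCLike.re ⟪A, DeltaEta F n K c₀ U₀ A⟫_ℂ + ‖projR (covLapSite F n K c₀ U₀) QU (DstarL2 F n K c₀ U₀ A)‖ ^ 2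
        + (a₀ * (c₀ / cB) * ((F.L : ℝ) ^ (K - n)) ^ 3) * ‖Qk F n K h c₀ cB U₀ A‖ ^ 2) := by
  have hc₀ : 0 < c₀ := Fact.out
  have hL : (0 : ℝ) < F.L := by have := F.hL.2; exact_mod_cast (by omega : 0 < F.L)
  have hε7 : 10 ^ 7 * (F.L : ℝ) ^ 3 * ε₀ ≤ 1 := by
    have h1 : (10 : ℝ) ^ 7 * (F.L : ℝ) ^ 3 * ε₀ ≤ 10 ^ 12 * (F.L : ℝ) ^ 3 * ε₀ := by
      have : 0 ≤ (F.L : ℝ) ^ 3 * ε₀ := by positivity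
      nlinarith
    exact h1.trans hε12
  have hc₁ : 0 < c₀ * ((F.L : ℝ) ^ 3) ^ (K - n) := by positivity
  have hseq₀ := Prop7PTermLocalGaugeKnit.hseq_of_htop F c₀ U₀ QU htop
  have hseq₁ := Prop7PTermLocalGaugeKnit.hseq_of_htop F c₀ (1 : GaugeField (F.P K) 0 (Matrix.specialUnitaryGroup (Fin 2) ℂ)) Q1 htop₁
  have hPL : ((F.P K).L : ℝ) = (F.L : ℝ) := by norm_cast
  have hconst : ((2 / ((1 + (25 / 8) * ((c₀ * ((F.L : ℝ) ^ 3) ^ (K - n)) * ((((F.P K).L : ℝ) ^ (F.P K).d) ^ (K - n))⁻¹ / c₀)) * (600 * (27 / 4 : ℝ) ^ 6 * (c₀ * ((F.L : ℝ) ^ 3) ^ (K - n) / (c₀ * ((F.L : ℝ) ^ 3) ^ (K - n))) + am))) ^ 2 * am)⁻¹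
      = ((2 / ((1 + 25 / 8) * (600 * (27 / 4 : ℝ) ^ 6 + am))) ^ 2 * am)⁻¹ := by
    rw [hPL, T3Family.P_d]
    have h3 : ((F.L : ℝ) ^ 3) ^ (K - n) ≠ 0 := by positivity
    field_simp
  have hDst : ∀ A : BondL2K ℂ 3 (periodsT3 F K) c₀ W₂, ‖DstarL2 F n K c₀ U₀ A‖ ^ 2 ≤ ‖projR (covLapSite F n K c₀ U₀) QU (DstarL2 F n K c₀ U₀ A)‖ ^ 2 + ((2 / ((1 + 25 / 8) * (600 * (27 / 4 : ℝ) ^ 6 + am))) ^ 2 * am)⁻¹ * ‖A‖ ^ 2 := by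
    intro A
    have hA := Prop7DivergenceAbsorptionOfRegPr.normSq_DstarL2_le_normSq_projR_add_of_regPr' F hε₀ hε7 U₀ hreg QU hseq₀ hnK (c₀ * ((F.L : ℝ) ^ 3) ^ (K - n)) hc₁ ham A
    rw [hconst] at hA
    exact hA
  have hP1abs : ∀ Y : PBond (F.P K) 0 → Matrix (Fin 2) (Fin 2) ℂ, ‖DstarL2 F n K c₀ 1 (toL2 F K c₀ Y)‖ ^ 2
      ≤ ‖projR (covLapSite F n K c₀ 1) Q1 (DstarL2 F n K c₀ 1 (toL2 F K c₀ Y))‖ ^ 2 + ((2 / ((1 + 25 / 8) * (600 * (27 / 4 : ℝ) ^ 6 + am))) ^ 2 * am)⁻¹ * ‖toL2 F K c₀ Y‖ ^ 2 := by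
    intro Y
    have hY := Prop7DivergenceAbsorptionOfRegPr.normSq_DstarL2_one_le_normSq_projR_add F hnK Q1 hseq₁ (c₀ * ((F.L : ℝ) ^ 3) ^ (K - n)) hc₁ ham (toL2 F K c₀ Y)
    rw [hconst] at hY
    exact hY
  have hcR : (0 : ℝ) ≤ ((2 / ((1 + 25 / 8) * (600 * (27 / 4 : ℝ) ^ 6 + am))) ^ 2 * am)⁻¹ := by positivity
  exact curvedTarget_member F h c₀ cB hε₀ hε hε12 U₀ hreg s hnK hs hwrap ha₀ QU htop Q1 htop₁ hker₁ hθ hθc hδP hsmall hcR hKP hDst hloc hP1abs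

end Summit.QuantumFields.YangMills.Theorems.Prop7LODAssemblyMember

end
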